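import Summits.FinalStateConjecture.FinalStateConjecture.Theorems.ZeroEnergyKerrOrBombSymplecticDualOfTheBombSig4
import Summits.FinalStateConjecture.FinalStateConjecture.Theorems.ZeroEnergyKerrOrBombStationaryLimitReductionKerrIsometryRigidityWave3Facts
import Summits.FinalStateConjecture.FinalStateConjecture.Theorems.ZeroEnergyKerrOrBombStationaryLimitReductionRecutCoveringJunctionCore
import Summits.FinalStateConjecture.FinalStateConjecture.Theorems.ZeroEnergyKerrOrBombStationaryLimitReductionMoncriefDualityReductionWave3
import Literature.Geometry.Lorentzian.LocalConstraintDeformation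
import HarnessLib

/-!
# Route ZeroEnergyKerrOrBomb · crux `StationaryLimitReduction` — vocabulary and registered stub STATEMENTS of
# reshape r7 of the line `symplectic-dual-of-the-bomb`: the line carried to the RE-TYPED summit (definitions only)

Fifth statement module of the line (after `…SymplecticDualOfTheBombDefs/Defs2/Sig/Sig4/Sig6`, p101414 / p114429 /
p116416 / p123321 / p126956), crux stmt-FinalStateConjecture-10021 (`ZeroEnergyKerrOrBomb.StationaryLimitReduction :=
KerrOrBomb → FinalStateConjecture`), lead prover-line-stmt-FinalStateConjecture-10021-c5-0, 2026-08-16/17.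

On 2026-08-16T21:18Z the summit `FinalStateConjecture` was RE-TYPED (p126844, semantic-vacuity audit T2): genericity is the
TAME notion `InitialDataSet.IsTameChristodoulouGeneric` (one fixed end, continuous mass, weighted continuity, immersion at
the base point), `HasExhaustiveCharts` carries honest radii, and the per-datum conclusion gained the intrinsic lower bound
`RaysStayInClosure 𝒟 O` and the chart time orientation `IsFutureOriented d`. The registered skeleton r5/r6 of this line no
longer elaborates (its composition concluded `IsChristodoulouGeneric`), and neither does the root vocabulary module's
read-back `OneLockedExplosion.summit_iff` (needs an operator maintenance write). This module states reshape r7 = r6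
carried HONESTLY to the re-typed summit:

* §0 `SummitPropertyT2 X D` — VERBATIM the lambda of the re-typed summit (`summitT2_iff` is `Iff.rfl`), with
  `summitPropertyT2_imp : SummitPropertyT2 → SummitProperty`;
  `IsOrientationCompatible 𝒟 d` — the settling charts of a stationary decomposition respect the time orientations:
  orthochronous motions; a hole chart pushes the (moved) adapted-chart image of a `𝓑ᵢ`-future vector which lands
  `𝒟`-timelike to a `𝒟`-FUTURE vector; the flat chart pushes `∂₀`, where it lands timelike, to the future (exact
  clauses about orientation only — causality of the push-forwards is NOT asserted here, it is eventually automatic from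
  the `C²` convergence and is the transfer stub's business);
  `SettlesDocWithT2 Q X D` — the r4 currency `SettlesDocWith' Q` plus the two clauses the re-type added, placed where they
  are honest hypotheses on the settling geometry: `RaysStayInClosure 𝒟 (O ∩ I⁻(docCharted d))` (complete null rays from
  the data stay in the closure of the SELF-DETERMINED d.o.c.) and `IsOrientationCompatible 𝒟 d`;
* §1 the r7 stub statements that changed or are new: `Sig7.stub_kerrIdentificationFuture` (1R-F5, classical: the
  `T`-equivariant Kerr identification `Θ` with `c > 0` maps Kerr's future timelike field `V_{M,a}` to `𝓑`-future vectors,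
  because `T` is future timelike on `M_ext`), `Sig7.stub_chartTransferT2` (1F re-opened by the re-type: the landed transfer
  `stub_chartTransferGeneral` — radii clause repaired, p130371 — PLUS the transfer of the ray clause and of the
  orientation), `Sig7.stub_nonSettlingCure` (stub 2 concluding the TAME IMMERSED witness shape of the re-typed genericity),
  `Sig7.stub_dualModeEjection` (stub 5 over the T2 currency, its steering curve now also IMMERSED at `0`; tameness is
  derived in the skeleton from compact support, `isTameDataFamily_restrict_of_agree_off_compact_one`).
  Unchanged and re-type-independent (keep their landed statements): 1R-F3/F4 `KerrHorizonExtension`,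
  `KerrAsymptoticRigidity` (p125844), 1G-core `RecutJunctionCore` (p125072), 3 `Sig.stub_probeUniversality`, 4-residual
  `LocalSingleDetectionAt` (p124620), and the r5 reductions to `Sig4.stub_kerrIsometryRigidity` / `Sig4.stub_recutCovering`.

Each `Sig7.stub_X` is a DEFINITION of a proposition (the text a stub worker must prove or refute); none is a route item,
none is asserted; the module does not import the route file; provenance in prose `(ref: Key, locator)`, not cite tags
(the stubs are the line's own obligations — precedent `…Sig/Sig4/Sig6`).
-/

-- every `Summit.FinalStateConjecture.FinalStateConjecture.…` name repeats the summit = sub-problem segment (D-0017 layout)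
set_option linter.dupNamespace false
set_option maxSynthPendingDepth 3

noncomputable section

open scoped Manifold ContDiff Topology BigOperators
open Set Filter Bundle MeasureTheory Literature.Geometry.Lorentzian

namespace Summit.FinalStateConjecture.FinalStateConjecture.Theorems.SymplecticDualOfTheBomb

open Summit.FinalStateConjecture.FinalStateConjecture.Theorems.OneLockedExplosion

/-! ## §0 Vocabulary of reshape r7 (definitions over the tree and the landed modules; nothing is asserted) -/

section Summit

variable (X : Type) [TopologicalSpace X] [ChartedSpace E3 X] [IsManifold (𝓡 3) ∞ X]
  [T2Space X] [SecondCountableTopology X] [ConnectedSpace X]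

/-- The property the RE-TYPED summit asserts generically of an admissible datum `D` on `X` — VERBATIM the lambda of
`FinalStateConjecture` after p126844 (so that `summitT2_iff` is `Iff.rfl`): an MGHD exists, and every MGHD has complete
`𝓘⁺` and a sub-extremal `N`-Kerr final-state decomposition `d` of its self-determined exterior `O` such that every
future-complete normalised null ray from the data stays in `closure O`, the charts exhaust `O` (honest radii), and chart
time is future-oriented. The pre-re-type lambda is `OneLockedExplosion.SummitProperty`. [cite: DafermosLuk2017, Conjecture 1 and §1.2.1] -/
def SummitPropertyT2 (D : InitialDataSet (𝓡 3) X) : Prop :=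
  (∃ 𝒟 : VacuumCauchyDevelopment D, 𝒟.IsMaximal) ∧
    ∀ 𝒟 : VacuumCauchyDevelopment D, 𝒟.IsMaximal →
      Summit.FinalStateConjecture.HasCompleteNullInfinity 𝒟.toCauchyDevelopment ∧
        ∃ (O : Set 𝒟.carrier) (d : FinalStateDecomposition 𝒟.toSpacetime O 2),
          (∀ i, Kerr.IsSubextremal (d.mass i) (d.spin i)) ∧
            O = Summit.FinalStateConjecture.exteriorOf 𝒟.toCauchyDevelopment d.charted ∧
              Summit.FinalStateConjecture.RaysStayInClosure 𝒟.toCauchyDevelopment O ∧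
                Summit.FinalStateConjecture.HasExhaustiveCharts d ∧
                  Summit.FinalStateConjecture.IsFutureOriented d

omit [T2Space X] [SecondCountableTopology X] in
/-- The re-typed per-datum property implies the pre-re-type one (forget the ray clause and the orientation clause).
[folklore] -/
theorem summitPropertyT2_imp {D : InitialDataSet (𝓡 3) X} (h : SummitPropertyT2 X D) : SummitProperty X D := by
  refine ⟨h.1, fun 𝒟 h𝒟 ↦ ?_⟩
  obtain ⟨hcni, O, d, hsub, hO, -, hex, -⟩ := h.2 𝒟 h𝒟
  exact ⟨hcni, O, d, hsub, hO, hex⟩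

end Summit

/-- The re-typed summit unfolded through `SummitPropertyT2` (definitional): TAME Christodoulou genericity of
`SummitPropertyT2` in the admissible class, on every slice. Registration device of this module. [folklore] -/
theorem summitT2_iff : _root_.FinalStateConjecture ↔ ∀ (X : Type) [TopologicalSpace X] [ChartedSpace E3 X] [IsManifold (𝓡 3) ∞ X] [T2Space X] [SecondCountableTopology X] [ConnectedSpace X], InitialDataSet.IsTameChristodoulouGeneric (admissibleVacuumData X) (SummitPropertyT2 X) 1 :=
  Iff.rfl

section Orientation

variable {X : Type} [TopologicalSpace X] [ChartedSpace E3 X] [IsManifold (𝓡 3) ∞ X]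
  [ConnectedSpace X] {D : InitialDataSet (𝓡 3) X}

/-- **The settling charts respect the time orientations** (r7; the clause the re-typed summit's `IsFutureOriented` needs
on the input side of the chart transfer). (i) Every asymptotic motion `Λᵢ` is orthochronous. (ii) For every hole `i`,
every LATE point `y` of the moved adapted background (rest-frame chart time `> τ₀`) and every `w : E4`: if the rest-frame vector `Λᵢ⁻¹ w`, pushed by the
adapted chart `Aᵢ` at `Λᵢ⁻¹(y − cᵢ)`, is FUTURE-directed for `𝓑ᵢ`, and the push-forward of `w` by the late chart `ψᵢ`
at `y` is timelike for `g_𝒟`, then that push-forward is future-directed for `(g_𝒟, τ_𝒟)`. (iii) Wherever, at a late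
point (`x⁰ > τ₀`), the flat chart pushes `∂₀` to a `g_𝒟`-timelike vector, that vector is future-directed. These are statements about the SIGN only
(future rather than past); that the relevant push-forwards are eventually timelike follows from the `C²` convergence on
the certified slabs and is not asserted here. Honest decompositions (charts read off a time function of `𝒟`) satisfy it
exactly; Kerr's own development with Kerr–Schild charts satisfies it. (ref: ONeill1983, Ch. 5 p. 145; DafermosLuk2017,
Conjecture 1) [cite: ONeill1983, Ch. 5  p. 145] -/
def IsOrientationCompatible (𝒟 : VacuumCauchyDevelopment D) {O : Set 𝒟.carrier} {k : ℕ}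
    (d : StationaryFinalStateDecomposition 𝒟.toSpacetime O k) : Prop :=
  (∀ i, Summit.FinalStateConjecture.IsOrthochronous (d.motion i).1) ∧
  (∀ (i : Fin d.N) (y : (d.background i).domain) (w : E4), d.toOver.τ₀ < (d.background i).time y.1 →
    (d.hole i).timeOrientation.IsFutureDirected
        (mfderiv 𝓘(ℝ, E4) (𝓡 4) (d.adapted i).toFun
          ⟨poincareInv (d.motion i).1 (d.motion i).2 y.1, ModelBackground.mem_boost_domain.1 y.2⟩
          (((d.motion i).1 : E4 ≃L[ℝ] E4).symm w)) →
      𝒟.metric.IsTimelike (mfderiv 𝓘(ℝ, E4) (𝓡 4) (d.toOver.chart i) y w) →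
        𝒟.timeOrientation.IsFutureDirected (mfderiv 𝓘(ℝ, E4) (𝓡 4) (d.toOver.chart i) y w)) ∧
  ∀ y : d.toOver.flatDomain, d.toOver.τ₀ < (y : E4) 0 →
    𝒟.metric.IsTimelike (mfderiv 𝓘(ℝ, E4) (𝓡 4) d.toOver.flatChart y (E4.basisVector 0)) →
      𝒟.timeOrientation.IsFutureDirected (mfderiv 𝓘(ℝ, E4) (𝓡 4) d.toOver.flatChart y (E4.basisVector 0))

end Orientation

/-- **"Every MGHD of `D` settles down to regular stationary vacuum holes with property `Q`", T2 form** — the r4/r5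
currency `SettlesDocWith' Q` (complete `𝓘⁺`; a `C²` stationary decomposition of the honest exterior
`O = exteriorOf 𝒟 d.charted`, exhaustive in the d.o.c. sense `HasExhaustiveDocCharts'`, horizon-normalised; regular
Kerr-chartable holes in the telescope, `I⁺`-regular, with property `Q`) PLUS the two clauses of the re-typed summit, as
hypotheses on the settling geometry: every future-complete normalised null ray from the data stays in the closure of the
self-determined d.o.c. `O ∩ I⁻(docCharted d)` (`RaysStayInClosure`), and the charts respect the time orientations
(`IsOrientationCompatible`). [cite: DafermosLuk2017, §1.2.1 and Conjecture 1] -/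
def SettlesDocWithT2 (Q : StationaryAFBlackHole.{0} → Prop) (X : Type) [TopologicalSpace X]
    [ChartedSpace E3 X] [IsManifold (𝓡 3) ∞ X] [T2Space X] [SecondCountableTopology X]
    [ConnectedSpace X] (D : InitialDataSet (𝓡 3) X) : Prop :=
  ∀ 𝒟 : VacuumCauchyDevelopment D, 𝒟.IsMaximal →
    Summit.FinalStateConjecture.HasCompleteNullInfinity 𝒟.toCauchyDevelopment ∧
      ∃ (O : Set 𝒟.carrier) (d : StationaryFinalStateDecomposition 𝒟.toSpacetime O 2),
        O = Summit.FinalStateConjecture.exteriorOf 𝒟.toCauchyDevelopment d.charted ∧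
          HasExhaustiveDocCharts' d ∧ IsHorizonNormalised d ∧
            Summit.FinalStateConjecture.RaysStayInClosure 𝒟.toCauchyDevelopment
              (O ∩ 𝒟.metric.chronologicalPast 𝒟.timeOrientation (docCharted d)) ∧
              IsOrientationCompatible 𝒟 d ∧
                ∀ i, (d.hole i).horizon ⊆ Set.range (d.adapted i).toFun ∧
                  ChartIsAsymptoticallyCartesian (d.adapted i) ∧
                    ChartIsAsymptoticallySchwarzschildean' (d.adapted i) ∧
                      InTelescope (d.hole i) ∧ (d.hole i).IsIPlusRegular ∧ Q (d.hole i)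

/-! ## §1 The restated / new stub statements of reshape r7 (precise `Prop`s `Sig7.stub_<name>`) -/

/-- **Stub 1R-F5 · `kerrIdentificationFuture` (NEW, classical, re-type-forced)** — the Kerr identification of a telescope
hole is future-preserving: if `Θ` is a `T`-equivariant (`Θ(x + s e₀) = Θ x + (c s) e₀`, `c > 0`) isometric identification
of the Kerr exterior `(Kerr.exterior M a, Kerr.bilin M a)` with the d.o.c. part of the adapted chart `A`
(`IsKerrChartedWith`), then at every point of the Kerr exterior the push-forward by `A ∘ Θ` of Kerr's future timelike
field `V_{M,a} = −g♯(dt*)` (`Kerr.timeVector`) is future-directed for `𝓑`. WHY TRUE: `dA(e₀) = T` is future timelike on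
`M_ext ⊆ doc` (structure field `isStationary`), so at a point of `Θ⁻¹(A⁻¹ M_ext)` the `A`-timelike vectors `dΘ(V)` and
`dΘ(e₀) = c e₀` lie in one cone (`g_{M,a}(V, e₀) = −1`, `Θ` isometric), whence `dA(dΘ V)` is future there; a continuous
nowhere-null timelike field on the connected `Kerr.exterior` cannot change cone. SIZE: M. (ref: ONeill1983, Ch. 5
Lemma 5.26 ff.; ChruscielCosta2008, §2.2) -/
def Sig7.stub_kerrIdentificationFuture : Prop :=
  ∀ (𝓑 : StationaryAFBlackHole.{0}) (A : 𝓑.AdaptedChart) (M a c r₀ : ℝ) (Θ : E4 → E4),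
    InTelescope 𝓑 → IsKerrChartedWith 𝓑 A M a c r₀ Θ →
      ∀ u ∈ (Kerr.exterior M a : Set E4), ∀ h : Θ u ∈ A.domain,
        𝓑.timeOrientation.IsFutureDirected
          (mfderiv 𝓘(ℝ, E4) (𝓡 4) A.toFun ⟨Θ u, h⟩ (fderiv ℝ Θ u (Kerr.timeVector M a u)))

/-- **Stub 1F-T2 · `chartTransferT2` (stub 1F RE-OPENED by the re-type)** — the chart transfer in general position with
the re-typed summit's per-datum conclusion: for a `C²` stationary decomposition `d` of the honest exterior
`O = exteriorOf 𝒟 d.charted`, exhaustive in the d.o.c. sense, horizon-normalised, with Kerr identifications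
`IsKerrChartedWith` of its holes which are future-preserving (conclusion of `Sig7.stub_kerrIdentificationFuture`), the
covering clauses of the naive recut (`KerrSchildRecutCovering`), complete rays staying in the closure of the
self-determined d.o.c., and orientation-compatible charts, there is a sub-extremal Kerr–Schild `FinalStateDecomposition d'`
of `O' = exteriorOf 𝒟 d'.charted` with `RaysStayInClosure 𝒟 O'`, exhaustive charts (honest radii) and future-oriented
chart time. The first three conjuncts are the landed `stub_chartTransferGeneral` (p121011; radii repaired p130371); the
ray clause transfers because `O ∩ I⁻(docCharted d) ⊆ O'` (every point of the self-determined d.o.c. is in the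
chronological past of the recut late images: `HasExhaustiveDocCharts'` (ii) at a late time + `Θ '' Kerr.exterior = A⁻¹ doc`
+ the tilt bound); `IsFutureOriented d'` from orthochronous motions, `IsOrientationCompatible`, future-preservation of
`Θᵢ`, and eventual timelikeness of the push-forwards of `Λᵢ V` / `∂₀` (from the `C²` convergence on the certified slabs,
`g_{M,a}(V, V) = −1 − 2H ≤ −1`). SIZE: L (the recut proof of p121011 re-run with three more outputs). (ref:
DafermosLuk2017, Conjecture 1 (b)–(c)) -/
def Sig7.stub_chartTransferT2 : Prop :=
  ∀ (X : Type) [TopologicalSpace X] [ChartedSpace E3 X] [IsManifold (𝓡 3) ∞ X]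
    [T2Space X] [SecondCountableTopology X] [ConnectedSpace X] (D : InitialDataSet (𝓡 3) X)
    (𝒟 : VacuumCauchyDevelopment D) (O : Set 𝒟.carrier)
    (d : StationaryFinalStateDecomposition 𝒟.toSpacetime O 2)
    (M a c r₀ : Fin d.N → ℝ) (Θ : Fin d.N → E4 → E4),
    O = Summit.FinalStateConjecture.exteriorOf 𝒟.toCauchyDevelopment d.charted →
    HasExhaustiveDocCharts' d → IsHorizonNormalised d →
    (∀ i, IsKerrChartedWith (d.hole i) (d.adapted i) (M i) (a i) (c i) (r₀ i) (Θ i)) →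
    (∀ i, ∀ u ∈ (Kerr.exterior (M i) (a i) : Set E4), ∀ h : Θ i u ∈ (d.adapted i).domain,
      (d.hole i).timeOrientation.IsFutureDirected
        (mfderiv 𝓘(ℝ, E4) (𝓡 4) (d.adapted i).toFun ⟨Θ i u, h⟩
          (fderiv ℝ (Θ i) u (Kerr.timeVector (M i) (a i) u)))) →
    KerrSchildRecutCovering 𝒟 d M a Θ →
    Summit.FinalStateConjecture.RaysStayInClosure 𝒟.toCauchyDevelopment
      (O ∩ 𝒟.metric.chronologicalPast 𝒟.timeOrientation (docCharted d)) →
    IsOrientationCompatible 𝒟 d →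
    ∃ (O' : Set 𝒟.carrier) (d' : FinalStateDecomposition 𝒟.toSpacetime O' 2),
      (∀ i, Kerr.IsSubextremal (d'.mass i) (d'.spin i)) ∧
        O' = Summit.FinalStateConjecture.exteriorOf 𝒟.toCauchyDevelopment d'.charted ∧
          Summit.FinalStateConjecture.RaysStayInClosure 𝒟.toCauchyDevelopment O' ∧
            Summit.FinalStateConjecture.HasExhaustiveCharts d' ∧
              Summit.FinalStateConjecture.IsFutureOriented d'

/-- **Stub 2 · `nonSettlingCure` (r7: T2 currency, TAME IMMERSED witness)** — the global half: data that do not settle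
regularly IN THE T2 D.O.C. SENSE (`SettlesDocWithT2 ⊤`), or that settle with an MGHD carrying a local Killing germ at
EVERY point of the slice, are curable by a witness curve of the RE-TYPED genericity: an end `e`, a family `F` tame on `e`
(`IsTameDataFamily`: jointly smooth, `e` sole, Dafermos–Rodnianski flat with continuous mass, `wDist`-continuous at
`0`), immersed at `0`, injective, admissible, `F 0 = D`, all of whose members off `0` settle (T2 d.o.c. sense) to
MODE-STABLE regular holes. SIZE: open problem (weak cosmic censorship in Christodoulou's instability form + large-data
settling + a dynamical third law + `I⁺`-regularity and rates of the limits + the two T2 clauses + the curing of symmetric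
exceptional data) — owed by every stationary-limit line, kept as ONE curve statement (Disproof §5); `KerrOrBomb ⊢ crux ↔
summit` (p122022). (ref: DafermosLuk2017, §1.2.1; Christodoulou1999, p. A24) -/
def Sig7.stub_nonSettlingCure : Prop :=
  ∀ (X : Type) [TopologicalSpace X] [ChartedSpace E3 X] [IsManifold (𝓡 3) ∞ X]
    [T2Space X] [SecondCountableTopology X] [ConnectedSpace X],
    ∀ D ∈ admissibleVacuumData X,
      (¬ SettlesDocWithT2 (fun _ ↦ True) X D ∨
        ∃ 𝒟 : VacuumCauchyDevelopment D, 𝒟.IsMaximal ∧ ∀ x : X, ¬ IsKIDFreeAt 𝒟 x) →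
      ∃ (e : AFEnd X) (F : EuclideanSpace ℝ (Fin 1) → InitialDataSet (𝓡 3) X),
        InitialDataSet.IsTameDataFamily e 1 F ∧ InitialDataSet.IsImmersedAtZero 1 F ∧ F 0 = D ∧
          Function.Injective F ∧ (∀ c, F c ∈ admissibleVacuumData X) ∧
            ∀ c : EuclideanSpace ℝ (Fin 1), c ≠ 0 → SettlesDocWithT2 ModeStable X (F c)

/-- **Stub 5 · `dualModeEjection` (r7: T2 currency, IMMERSED steering curve)** — the symplectic dual of the bomb detects
at a germ-KID-free point, and transversal steerable families escape: for an admissible `D`, an MGHD with complete `𝓘⁺` and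
a `C²` stationary decomposition in the T2 d.o.c. sense (honest exterior, `HasExhaustiveDocCharts'`, horizon-normalised,
complete rays in the closure of the self-determined d.o.c., orientation-compatible charts, regular holes) whose hole `i`
carries a growing gravitational Killing-mode pair, and which HAS a germ-KID-free point: there are a germ-KID-free point
`x₀` and finitely many SYMMETRIC detectors at `x₀` such that every jointly smooth admissible `k`-family `G` through `D`
supported in the chart source at `x₀` with non-degenerate pairing matrix contains a jointly smooth curve `F`
(`F c = G c'`), IMMERSED at `0`, injective on a window `‖c‖ < ε`, all of whose members `0 < ‖c‖ < ε` settle (T2 d.o.c.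
sense) to MODE-STABLE regular holes. (Tameness of `F` is not asked: it follows from compact support,
`isTameDataFamily_restrict_of_agree_off_compact_one`.) Debts (all absent from print): dual-mode transport by the conserved
symplectic current, local non-gauge-ness of the dual mode, the saddle and the fate of the explosion. (ref:
DafermosLuk2017, §1.2.1; Christodoulou1999, p. A24) -/
def Sig7.stub_dualModeEjection : Prop :=
  ∀ (X : Type) [TopologicalSpace X] [ChartedSpace E3 X] [IsManifold (𝓡 3) ∞ X]
    [T2Space X] [SecondCountableTopology X] [ConnectedSpace X],
    ∀ D ∈ admissibleVacuumData X, ∀ (𝒟 : VacuumCauchyDevelopment D), 𝒟.IsMaximal →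
      Summit.FinalStateConjecture.HasCompleteNullInfinity 𝒟.toCauchyDevelopment →
      ∀ (O : Set 𝒟.carrier) (d : StationaryFinalStateDecomposition 𝒟.toSpacetime O 2),
        O = Summit.FinalStateConjecture.exteriorOf 𝒟.toCauchyDevelopment d.charted →
        HasExhaustiveDocCharts' d → IsHorizonNormalised d →
        Summit.FinalStateConjecture.RaysStayInClosure 𝒟.toCauchyDevelopment
          (O ∩ 𝒟.metric.chronologicalPast 𝒟.timeOrientation (docCharted d)) →
        IsOrientationCompatible 𝒟 d →
        (∀ i, (d.hole i).horizon ⊆ Set.range (d.adapted i).toFun ∧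
          ChartIsAsymptoticallyCartesian (d.adapted i) ∧
            ChartIsAsymptoticallySchwarzschildean' (d.adapted i) ∧
              InTelescope (d.hole i) ∧ (d.hole i).IsIPlusRegular) →
        ∀ (i : Fin d.N) (ν ϖ : ℝ) (h₁ h₂ : HoleBilinField (d.hole i)), 0 < ν →
          IsGravitationalModePair (d.hole i) (d.adapted i) ν ϖ h₁ h₂ →
          (∃ x : X, IsKIDFreeAt 𝒟 x) →
          ∃ (x₀ : X) (k : ℕ) (A B : Fin k → BilinField X), AreSymmDetectorsAt 𝒟 x₀ A B ∧
            ∀ G : EuclideanSpace ℝ (Fin k) → InitialDataSet (𝓡 3) X,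
              InitialDataSet.IsSmoothDataFamily k G → G 0 = D → (∀ c, G c ∈ admissibleVacuumData X) →
              (∃ K : Set X, IsCompact K ∧ K ⊆ (extChartAt (𝓡 3) x₀).source ∧ IsSupportedIn D G K) →
              (pairingMatrix D x₀ A B G).det ≠ 0 →
              ∃ (ε : ℝ) (F : EuclideanSpace ℝ (Fin 1) → InitialDataSet (𝓡 3) X), 0 < ε ∧
                InitialDataSet.IsSmoothDataFamily 1 F ∧ InitialDataSet.IsImmersedAtZero 1 F ∧ F 0 = D ∧
                (∀ c, ∃ c', F c = G c') ∧
                (∀ c c' : EuclideanSpace ℝ (Fin 1), ‖c‖ < ε → ‖c'‖ < ε → F c = F c' → c = c') ∧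
                ∀ c : EuclideanSpace ℝ (Fin 1), c ≠ 0 → ‖c‖ < ε → SettlesDocWithT2 ModeStable X (F c)

/-- **Stub 1R-residuals (r7 registration device)** — the conjunction of the three residual obligations of stub 1R:
F3 `KerrHorizonExtension` ∧ F4 `KerrAsymptoticRigidity` (r6, p125844, unprinted) ∧ F5 `Sig7.stub_kerrIdentificationFuture`
(new, classical). Registered as ONE stub (stubs_max); its conjuncts land separately as helpers. (ref: ChruscielCosta2008,
Thm. 1.3 and §4) -/
def Sig7.stub_kerrIsometryResiduals : Prop :=
  KerrHorizonExtension ∧ KerrAsymptoticRigidity ∧ Sig7.stub_kerrIdentificationFuture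

/-- **Stub 4-residuals (r7 registration device)** — the two obligations left of stub 4 (`Sig.stub_moncriefFacts`, via the
wave-3 reduction `stub_moncriefFacts_of_facts`, p124620): the CITED Literature fact
`ChruscielDelay_localConstraintDeformation` (local constraint deformation off germ-KIDs; Chruściel–Delay 2003 Thm. 5.9 /
Corvino–Schoen 2006 — a literature debt, closed by its `_holds` theorem and by nothing else) ∧ the localised Moncrief
annihilator lemma in single-detector form (`LocalSingleDetectionAt`, the r6 worker residual). (ref: ChruscielDelay2003,
Thm. 5.9; Moncrief1975, §IV) -/
def Sig7.stub_moncriefResiduals : Prop :=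
  Literature.Geometry.Lorentzian.ChruscielDelay_localConstraintDeformation ∧
    ∀ (X : Type) [TopologicalSpace X] [ChartedSpace E3 X] [IsManifold (𝓡 3) ∞ X] [T2Space X]
      [SecondCountableTopology X] [ConnectedSpace X] (D : InitialDataSet (𝓡 3) X)
      (𝒟 : VacuumCauchyDevelopment D) (x₀ : X), LocalSingleDetectionAt 𝒟 x₀

/-- **Stub 1G-core (r7 registration device)** — `RecutJunctionCore` (p125072) by name. (ref: DafermosLuk2017,
Conjecture 1 (b)–(c)) -/
def Sig7.stub_recutJunctionCore : Prop :=
  RecutJunctionCore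

/-! ## §2 Read-backs and monotonicity (registration devices; sorry-free) -/

/-- Read-back of `SettlesDocWithT2` (definitional). [folklore] -/
theorem settlesDocWithT2_iff : ∀ (Q : StationaryAFBlackHole.{0} → Prop) (X : Type) [TopologicalSpace X] [ChartedSpace E3 X] [IsManifold (𝓡 3) ∞ X] [T2Space X] [SecondCountableTopology X] [ConnectedSpace X] (D : InitialDataSet (𝓡 3) X), SettlesDocWithT2 Q X D ↔ ∀ 𝒟 : VacuumCauchyDevelopment D, 𝒟.IsMaximal → Summit.FinalStateConjecture.HasCompleteNullInfinity 𝒟.toCauchyDevelopment ∧ ∃ (O : Set 𝒟.carrier) (d : StationaryFinalStateDecomposition 𝒟.toSpacetime O 2), O = Summit.FinalStateConjecture.exteriorOf 𝒟.toCauchyDevelopment d.charted ∧ HasExhaustiveDocCharts' d ∧ IsHorizonNormalised d ∧ Summit.FinalStateConjecture.RaysStayInClosure 𝒟.toCauchyDevelopment (O ∩ 𝒟.metric.chronologicalPast 𝒟.timeOrientation (docCharted d)) ∧ IsOrientationCompatible 𝒟 d ∧ ∀ i, (d.hole i).horizon ⊆ Set.range (d.adapted i).toFun ∧ ChartIsAsymptoticallyCartesian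 (d.adapted i) ∧ ChartIsAsymptoticallySchwarzschildean' (d.adapted i) ∧ InTelescope (d.hole i) ∧ (d.hole i).IsIPlusRegular ∧ Q (d.hole i) :=
  fun _ _ _ _ _ _ _ _ _ ↦ Iff.rfl

/-- `SettlesDocWithT2` is monotone in the hole property (used by the skeleton's `exists_bomb_docT2`). [folklore] -/
theorem settlesDocWithT2_mono : ∀ (Q Q' : StationaryAFBlackHole.{0} → Prop) (X : Type) [TopologicalSpace X] [ChartedSpace E3 X] [IsManifold (𝓡 3) ∞ X] [T2Space X] [SecondCountableTopology X] [ConnectedSpace X] (D : InitialDataSet (𝓡 3) X), (∀ 𝓑, Q 𝓑 → Q' 𝓑) → SettlesDocWithT2 Q X D → SettlesDocWithT2 Q' X D := by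
  intro Q Q' X _ _ _ _ _ _ D hQ h 𝒟 h𝒟
  obtain ⟨hcni, O, d, hO, hex, hnorm, hrays, hor, hholes⟩ := h 𝒟 h𝒟
  exact ⟨hcni, O, d, hO, hex, hnorm, hrays, hor, fun i ↦ ⟨(hholes i).1, (hholes i).2.1, (hholes i).2.2.1,
    (hholes i).2.2.2.1, (hholes i).2.2.2.2.1, hQ _ (hholes i).2.2.2.2.2⟩⟩

/-- The T2 currency forgets to the r4 currency `SettlesDocWith'` (drop the ray and orientation clauses). [folklore] -/
theorem SettlesDocWithT2.settlesDocWith' : ∀ (Q : StationaryAFBlackHole.{0} → Prop) (X : Type) [TopologicalSpace X] [ChartedSpace E3 X] [IsManifold (𝓡 3) ∞ X] [T2Space X] [SecondCountableTopology X] [ConnectedSpace X] (D : InitialDataSet (𝓡 3) X), SettlesDocWithT2 Q X D → SettlesDocWith' Q X D := by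
  intro Q X _ _ _ _ _ _ D h 𝒟 h𝒟
  obtain ⟨hcni, O, d, hO, hex, hnorm, -, -, hholes⟩ := h 𝒟 h𝒟
  exact ⟨hcni, O, d, hO, hex, hnorm, hholes⟩

end Summit.FinalStateConjecture.FinalStateConjecture.Theorems.SymplecticDualOfTheBomb

end
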